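import Mathlib.Data.ZMod.Basic
import Mathlib.Data.Matrix.Mul
import Mathlib.Algebra.BigOperators.Ring.Finset
import Mathlib.Algebra.BigOperators.Pi
import Mathlib.Algebra.Order.BigOperators.Group.Finset
import Mathlib.Data.Real.Basic
import Mathlib.Tactic.Positivity
import Mathlib.Tactic.FieldSimp
import Mathlib.Tactic.Linarith
import Mathlib.Tactic.GCongr
import Mathlib.Tactic.Ring
import HarnessLib

/-!
# The Goldreich–Levin theorem: local list decoding of the Hadamard code (combinatorial core)

Trunk `CryptoQuantFine` / `CplxMeta`. Third instalment of the decomposition of the named fact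
`Literature.Computability.Learning.cikk_natural_implies_learning` (CIKK 2016, Thm. 5.1), covering the mathematical
content of CIKK Thm. 4.2 for `p = 2` = the Goldreich–Levin theorem in Rackoff's form
(Arora–Barak 2009, Thm. 9.12 and its proof, pp. 218–222): from a predictor `B : 𝔽₂ⁿ → 𝔽₂`
agreeing with the linear function `r ↦ ⟨x, r⟩` on a `1/2 + γ` fraction of points one computes,
with `n (2^k - 1)` queries to `B` and `k` random seeds `s¹, …, s^k ∈ 𝔽₂ⁿ`, a list of `2^k`
candidates containing `x` with probability `≥ 1 - n / (4γ²(2^k - 1))` over the seeds.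
Everything is proved; the statement is the exact finite-probability (counting) form, no
algorithms or machines are involved (running time is a separate, later step).

## Contents

* `seedSum s T = Σ_{t∈T} sᵗ` (the pairwise independent combined queries `r_T`), `glVote`,
  `nonemptySubsets`, `glCandidate B k s σ` (coordinate-wise majority vote of
  `σ_T + B(r_T + eᵢ)` over nonempty `T`, for a guess `σ` of the bits `⟨x, sᵗ⟩`), `glList B k s`
  (all `2^k` candidates; `card_glList_le`), `trueGuess`.
* Fibre counting: `card_fibre_seedSum` (`#{s : r_T(s) = v} = |Ω|/|V|`, uniformity) and
  `card_fibre_seedSum_pair` (`#{s : r_T(s) = v, r_{T'}(s) = v'} = |Ω|/|V|²` for distinct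
  nonempty `T, T'`, pairwise independence — via explicit preimages and translation).
* Second moment: `correctVotes` (`Z`), `sum_correctVotes` (`E Z`), `sum_correctVotes_sq`
  (`E Z²`), `sum_sq_deviation` (`Σ (Z - mp)² = |Ω| m p (1-p)`), `card_badSeeds_le`
  (Chebyshev: `#{s : Z(s) ≤ m/2} ≤ |Ω|/(4γ²m)`), `glCandidate_trueGuess_apply` (majority is
  right when `Z > m/2`), `goldreich_levin_core` (union bound over the `n` coordinates) and
  `goldreich_levin_half` (`2^k - 1 ≥ n/(2γ²)` queries give success probability `≥ 1/2`, the
  form quoted in CIKK Thm. 4.2).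

## Design choices

* Vectors are `BVec n = Fin n → ZMod 2` with Mathlib's `dotProduct` (`⬝ᵥ`), so that linearity
  (`⟨x, r_T + eᵢ⟩ = Σ_{t∈T} ⟨x, sᵗ⟩ + xᵢ`) is `dotProduct_add/sum/single`; the Boolean interface
  (`Bool ≃ ZMod 2`) is left to the user files.
* Probabilities are exact counts over the uniform seed space `Ω = (𝔽₂ⁿ)^k`, in `ℝ`.
* All `2^k - 1` nonempty subsets are used (`m = 2^k - 1`), as in Arora–Barak ("`m ≤ 2^k - 1`").

## References

* S. Arora, B. Barak, *Computational Complexity: A Modern Approach*, CUP 2009, Thm. 9.12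
  (Goldreich–Levin) and its proof (Rackoff's argument; "Algorithm B′", pairwise independence,
  Chebyshev), pp. 218–222; notes p. 235 [AroraBarak2009] (text checked).
* O. Goldreich, L. Levin, *A hard-core predicate for all one-way functions*, STOC 1989.
* M. Carmosino, R. Impagliazzo, V. Kabanets, A. Kolokolova, *Learning algorithms from natural
  proofs*, CCC 2016, Thm. 4.2 (GL reconstruction over `GF(p)`; here `p = 2`)
  [CarmosinoImpagliazzoKabanetsKolokolova2016].
-/

namespace Literature.Computability.Cryptography

open Finset Matrix

/-- Bit vectors of length `n` over `𝔽₂`. [folklore] -/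
abbrev BVec (n : ℕ) : Type := Fin n → ZMod 2

variable {n kk : ℕ}

/-! ### Rackoff's estimator -/

/-- The combined query point `r_T(s) = Σ_{t ∈ T} sᵗ` of a seed tuple `s = (s¹, …, s^k)` and a
subset `T ⊆ [k]` (pairwise independent over nonempty `T`).
[cite: AroraBarak2009, Thm. 9.12 (proof, "define `r^j = Σ_{t ∈ T_j} s^t`")] -/
def seedSum (s : Fin kk → BVec n) (T : Finset (Fin kk)) : BVec n := ∑ t ∈ T, s t

/-- The vote of subset `T` for coordinate `i` under the guess `σ` for the bits `⟨x, sᵗ⟩`: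
`σ_T + B(r_T + eᵢ)` where `σ_T = Σ_{t∈T} σ_t` (AB: "guess that `xᵢ` is the majority value among
`z_j ⊕ z'_j`", with `z_j = x ⊙ r^j` known from the guesses).
[cite: AroraBarak2009, Thm. 9.12 (proof, Algorithm B′)] -/
def glVote (B : BVec n → ZMod 2) (s : Fin kk → BVec n) (σ : Fin kk → ZMod 2)
    (T : Finset (Fin kk)) (i : Fin n) : ZMod 2 :=
  (∑ t ∈ T, σ t) + B (seedSum s T + Pi.single i 1)

/-- The nonempty subsets of `[k]`, indexing the `m = 2^k - 1` pairwise independent queries.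
[cite: AroraBarak2009, Thm. 9.12 (proof)] -/
def nonemptySubsets (kk : ℕ) : Finset (Finset (Fin kk)) := univ.filter fun T => T.Nonempty

/-- There are `2^k - 1` nonempty subsets. [folklore] -/
theorem card_nonemptySubsets (kk : ℕ) : (nonemptySubsets kk).card = 2 ^ kk - 1 := by
  unfold nonemptySubsets
  have : (univ.filter fun T : Finset (Fin kk) => T.Nonempty) = univ.erase ∅ := by
    ext T; simp [Finset.nonempty_iff_ne_empty]
  rw [this, card_erase_of_mem (mem_univ _), card_univ, Fintype.card_finset, Fintype.card_fin]

/-- **Rackoff's candidate** for the secret under the guess `σ`: coordinate `i` is the majority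
vote over the nonempty subsets `T`. [cite: AroraBarak2009, Thm. 9.12 (proof, Algorithm B′)] -/
def glCandidate (B : BVec n → ZMod 2) (kk : ℕ) (s : Fin kk → BVec n) (σ : Fin kk → ZMod 2) :
    BVec n := fun i =>
  if (nonemptySubsets kk).card <
      2 * ((nonemptySubsets kk).filter fun T => glVote B s σ T i = 1).card then 1 else 0

/-- **The Goldreich–Levin list**: the candidates for all `2^k` guesses `σ`.
[cite: AroraBarak2009, Thm. 9.12 (proof: "for every string `w ∈ {0,1}^k` … add `z¹ … zⁿ` to the
list"); CarmosinoImpagliazzoKabanetsKolokolova2016, Thm. 4.2] -/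
def glList (B : BVec n → ZMod 2) (kk : ℕ) (s : Fin kk → BVec n) : Finset (BVec n) :=
  univ.image fun σ : Fin kk → ZMod 2 => glCandidate B kk s σ

/-- The list has at most `2^k` elements. [folklore] -/
theorem card_glList_le (B : BVec n → ZMod 2) (kk : ℕ) (s : Fin kk → BVec n) :
    (glList B kk s).card ≤ 2 ^ kk :=
  card_image_le.trans (by simp)

/-- The correct guess `σ*_t = ⟨x, sᵗ⟩`. [folklore] -/
def trueGuess (x : BVec n) (s : Fin kk → BVec n) : Fin kk → ZMod 2 := fun t => x ⬝ᵥ s t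

/-- The candidate for the correct guess is on the list. [folklore] -/
theorem glCandidate_trueGuess_mem (B : BVec n → ZMod 2) (x : BVec n) (s : Fin kk → BVec n) :
    glCandidate B kk s (trueGuess x s) ∈ glList B kk s :=
  mem_image_of_mem _ (mem_univ _)

/-! ### Linear algebra of the queries -/

/-- `seedSum` is additive in the seed tuple. [folklore] -/
theorem seedSum_add (s s' : Fin kk → BVec n) (T : Finset (Fin kk)) :
    seedSum (s + s') T = seedSum s T + seedSum s' T := by
  simp [seedSum, Finset.sum_add_distrib]

/-- `seedSum` is compatible with subtraction. [folklore] -/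
theorem seedSum_sub (s s' : Fin kk → BVec n) (T : Finset (Fin kk)) :
    seedSum (s - s') T = seedSum s T - seedSum s' T := by
  simp [seedSum, Finset.sum_sub_distrib]

/-- `seedSum` of a tuple supported at one index. [folklore] -/
theorem seedSum_single (t₀ : Fin kk) (v : BVec n) (T : Finset (Fin kk)) :
    seedSum (Pi.single t₀ v : Fin kk → BVec n) T = if t₀ ∈ T then v else 0 := by
  simp [seedSum, Finset.sum_pi_single']

/-- `⟨x, r_T + eᵢ⟩ = Σ_{t∈T} ⟨x, sᵗ⟩ + xᵢ` (linearity of the inner product). [folklore] -/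
theorem dotProduct_seedSum_add_single (x : BVec n) (s : Fin kk → BVec n) (T : Finset (Fin kk))
    (i : Fin n) : x ⬝ᵥ (seedSum s T + Pi.single i 1) = (∑ t ∈ T, x ⬝ᵥ s t) + x i := by
  rw [dotProduct_add, seedSum, dotProduct_sum, dotProduct_single, mul_one]

/-- Under the correct guess, the vote of `T` for coordinate `i` is right iff `B` is right at the
query point `r_T + eᵢ` (AB: "`x ⊙ (r ⊕ eⁱ) = (x ⊙ r) ⊕ (x ⊙ eⁱ)`").
[cite: AroraBarak2009, Thm. 9.12 (proof)] -/
theorem glVote_trueGuess_eq_iff (B : BVec n → ZMod 2) (x : BVec n) (s : Fin kk → BVec n)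
    (T : Finset (Fin kk)) (i : Fin n) :
    glVote B s (trueGuess x s) T i = x i ↔
      B (seedSum s T + Pi.single i 1) = x ⬝ᵥ (seedSum s T + Pi.single i 1) := by
  rw [dotProduct_seedSum_add_single, glVote]
  simp only [trueGuess]
  generalize (∑ t ∈ T, x ⬝ᵥ s t) = a
  generalize B (seedSum s T + Pi.single i 1) = b
  generalize x i = c
  revert a b c; decide

/-! ### Uniformity and pairwise independence of the query points (counting fibres) -/

section Fibres

variable (kk)

/-- All fibres of `s ↦ r_T(s)` (`T` nonempty) have the size of the zero fibre. [folklore] -/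
theorem card_fibre_seedSum_eq (T : Finset (Fin kk)) (hT : T.Nonempty) (v : BVec n) :
    (univ.filter fun s : Fin kk → BVec n => seedSum s T = v).card =
      (univ.filter fun s : Fin kk → BVec n => seedSum s T = 0).card := by
  obtain ⟨t₀, ht₀⟩ := hT
  set s₀ : Fin kk → BVec n := Pi.single t₀ v
  have hs₀ : seedSum s₀ T = v := by rw [seedSum_single, if_pos ht₀]
  have : (univ.filter fun s : Fin kk → BVec n => seedSum s T = v) =
      (univ.filter fun s : Fin kk → BVec n => seedSum s T = 0).map (addRightEmbedding s₀) := by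
    ext s
    simp only [mem_filter, mem_univ, true_and, mem_map, addRightEmbedding_apply]
    constructor
    · intro h
      exact ⟨s - s₀, by rw [seedSum_sub, h, hs₀, sub_self], sub_add_cancel s s₀⟩
    · rintro ⟨s', hs', rfl⟩
      rw [seedSum_add, hs', hs₀, zero_add]
  rw [this, card_map]

/-- **Uniformity of a single query point**: `#{s : r_T(s) = v} = |Ω| / |V|` for nonempty `T`.
[cite: AroraBarak2009, Thm. 9.12 (proof, "the string `r ⊕ eⁱ` is also uniformly distributed")] -/
theorem card_fibre_seedSum (T : Finset (Fin kk)) (hT : T.Nonempty) (v : BVec n) :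
    ((univ.filter fun s : Fin kk → BVec n => seedSum s T = v).card : ℝ) =
      Fintype.card (Fin kk → BVec n) / Fintype.card (BVec n) := by
  have hV : (0 : ℝ) < Fintype.card (BVec n) := Nat.cast_pos.2 Fintype.card_pos
  rw [eq_div_iff hV.ne']
  -- the fibres partition `Ω` and all have the same size
  have hpart := Finset.card_eq_sum_card_fiberwise (s := (univ : Finset (Fin kk → BVec n)))
    (t := (univ : Finset (BVec n))) (f := fun s => seedSum s T) fun _ _ => mem_univ _
  simp_rw [card_fibre_seedSum_eq kk T hT, Finset.sum_const, card_univ, smul_eq_mul] at hpart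
  rw [card_fibre_seedSum_eq kk T hT v, hpart]
  push_cast; ring

/-- An explicit seed tuple with prescribed values of two distinct nonempty combined queries
(auxiliary case: `t₀ ∈ T \ T'`). [folklore] -/
theorem exists_seedSum_pair_aux {T T' : Finset (Fin kk)} {t₀ : Fin kk} (h₀ : t₀ ∈ T)
    (h₀' : t₀ ∉ T') (hT' : T'.Nonempty) (v v' : BVec n) :
    ∃ s₀ : Fin kk → BVec n, seedSum s₀ T = v ∧ seedSum s₀ T' = v' := by
  obtain ⟨t₁, h₁⟩ := hT'
  by_cases h₁T : t₁ ∈ T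
  · refine ⟨Pi.single t₀ (v - v') + Pi.single t₁ v', ?_, ?_⟩ <;>
      simp [seedSum_add, seedSum_single, h₀, h₀', h₁, h₁T]
  · refine ⟨Pi.single t₀ v + Pi.single t₁ v', ?_, ?_⟩ <;>
      simp [seedSum_add, seedSum_single, h₀, h₀', h₁, h₁T]

/-- An explicit seed tuple with prescribed values of two distinct nonempty combined queries.
[folklore] -/
theorem exists_seedSum_pair {T T' : Finset (Fin kk)} (hT : T.Nonempty) (hT' : T'.Nonempty)
    (hne : T ≠ T') (v v' : BVec n) :
    ∃ s₀ : Fin kk → BVec n, seedSum s₀ T = v ∧ seedSum s₀ T' = v' := by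
  by_cases hsub : T ⊆ T'
  · have : ¬ T' ⊆ T := fun h => hne (Finset.Subset.antisymm hsub h)
    obtain ⟨t₀, h₀, h₀'⟩ := Finset.not_subset.1 this
    obtain ⟨s₀, h1, h2⟩ := exists_seedSum_pair_aux kk h₀ h₀' hT v' v
    exact ⟨s₀, h2, h1⟩
  · obtain ⟨t₀, h₀, h₀'⟩ := Finset.not_subset.1 hsub
    exact exists_seedSum_pair_aux kk h₀ h₀' hT' v v'

/-- All fibres of `s ↦ (r_T(s), r_{T'}(s))` have the size of the zero fibre. [folklore] -/
theorem card_fibre_seedSum_pair_eq {T T' : Finset (Fin kk)} (hT : T.Nonempty)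
    (hT' : T'.Nonempty) (hne : T ≠ T') (v v' : BVec n) :
    (univ.filter fun s : Fin kk → BVec n => seedSum s T = v ∧ seedSum s T' = v').card =
      (univ.filter fun s : Fin kk → BVec n => seedSum s T = 0 ∧ seedSum s T' = 0).card := by
  obtain ⟨s₀, hs₀, hs₀'⟩ := exists_seedSum_pair kk hT hT' hne v v'
  have : (univ.filter fun s : Fin kk → BVec n => seedSum s T = v ∧ seedSum s T' = v') =
      (univ.filter fun s : Fin kk → BVec n => seedSum s T = 0 ∧ seedSum s T' = 0).map
        (addRightEmbedding s₀) := by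
    ext s
    simp only [mem_filter, mem_univ, true_and, mem_map, addRightEmbedding_apply]
    constructor
    · rintro ⟨h, h'⟩
      exact ⟨s - s₀, ⟨by rw [seedSum_sub, h, hs₀, sub_self],
        by rw [seedSum_sub, h', hs₀', sub_self]⟩, sub_add_cancel s s₀⟩
    · rintro ⟨s', ⟨hs', hs''⟩, rfl⟩
      exact ⟨by rw [seedSum_add, hs', hs₀, zero_add], by rw [seedSum_add, hs'', hs₀', zero_add]⟩
  rw [this, card_map]

/-- **Pairwise independence of the query points**: for distinct nonempty `T, T'`,
`#{s : r_T(s) = v, r_{T'}(s) = v'} = |Ω| / |V|²`. [cite: AroraBarak2009, Thm. 9.12 (proof,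
"the strings `r¹, …, r^m` are pairwise independent") and Ex. 8.4] -/
theorem card_fibre_seedSum_pair {T T' : Finset (Fin kk)} (hT : T.Nonempty) (hT' : T'.Nonempty)
    (hne : T ≠ T') (v v' : BVec n) :
    ((univ.filter fun s : Fin kk → BVec n => seedSum s T = v ∧ seedSum s T' = v').card : ℝ) =
      Fintype.card (Fin kk → BVec n) / (Fintype.card (BVec n)) ^ 2 := by
  have hV : (0 : ℝ) < Fintype.card (BVec n) := Nat.cast_pos.2 Fintype.card_pos
  rw [eq_div_iff (by positivity)]
  have hpart := Finset.card_eq_sum_card_fiberwise (s := (univ : Finset (Fin kk → BVec n)))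
    (t := (univ : Finset (BVec n × BVec n))) (f := fun s => (seedSum s T, seedSum s T'))
    fun _ _ => mem_univ _
  have hfib : ∀ p : BVec n × BVec n,
      (univ.filter fun s : Fin kk → BVec n => (seedSum s T, seedSum s T') = p).card =
        (univ.filter fun s : Fin kk → BVec n => seedSum s T = 0 ∧ seedSum s T' = 0).card := by
    rintro ⟨w, w'⟩
    rw [← card_fibre_seedSum_pair_eq kk hT hT' hne w w']
    congr 1; ext s; simp [Prod.ext_iff]
  simp_rw [hfib, Finset.sum_const, card_univ, smul_eq_mul, Fintype.card_prod] at hpart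
  rw [card_fibre_seedSum_pair_eq kk hT hT' hne v v', hpart]
  push_cast; ring

end Fibres

/-! ### The second-moment analysis -/

section Analysis

variable (kk)

/-- The query point `r_T + eᵢ` of subset `T` for coordinate `i`. [folklore] -/
def glQuery (s : Fin kk → BVec n) (T : Finset (Fin kk)) (i : Fin n) : BVec n :=
  seedSum s T + Pi.single i 1

/-- Counting seeds whose query point lies in a set `G`: `|G| · |Ω| / |V|` (uniformity).
[cite: AroraBarak2009, Thm. 9.12 (proof)] -/
theorem card_filter_glQuery_mem (T : Finset (Fin kk)) (hT : T.Nonempty) (i : Fin n)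
    (G : Finset (BVec n)) :
    ((univ.filter fun s : Fin kk → BVec n => glQuery kk s T i ∈ G).card : ℝ) =
      G.card * (Fintype.card (Fin kk → BVec n) / Fintype.card (BVec n)) := by
  have h := Finset.card_eq_sum_card_fiberwise
    (s := univ.filter fun s : Fin kk → BVec n => glQuery kk s T i ∈ G) (t := G)
    (f := fun s => glQuery kk s T i) fun s hs => (mem_filter.1 hs).2
  rw [h, Nat.cast_sum]
  have : ∀ v ∈ G, (((univ.filter fun s : Fin kk → BVec n => glQuery kk s T i ∈ G).filter
      fun s => glQuery kk s T i = v).card : ℝ) =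
        Fintype.card (Fin kk → BVec n) / Fintype.card (BVec n) := by
    intro v hv
    rw [Finset.filter_filter, ← card_fibre_seedSum kk T hT (v - Pi.single i 1)]
    congr 2; ext s'
    simp only [mem_filter, mem_univ, true_and, glQuery]
    constructor
    · rintro ⟨-, h⟩; rw [← h, add_sub_cancel_right]
    · intro h; rw [h, sub_add_cancel]; exact ⟨hv, rfl⟩
  rw [Finset.sum_congr rfl this, Finset.sum_const, nsmul_eq_mul]

/-- Counting seeds whose query points for two distinct nonempty subsets both lie in `G`:
`|G|² · |Ω| / |V|²` (pairwise independence). [cite: AroraBarak2009, Thm. 9.12 (proof)] -/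
theorem card_filter_glQuery_mem_pair {T T' : Finset (Fin kk)} (hT : T.Nonempty)
    (hT' : T'.Nonempty) (hne : T ≠ T') (i : Fin n) (G : Finset (BVec n)) :
    ((univ.filter fun s : Fin kk → BVec n =>
        glQuery kk s T i ∈ G ∧ glQuery kk s T' i ∈ G).card : ℝ) =
      G.card ^ 2 * (Fintype.card (Fin kk → BVec n) / Fintype.card (BVec n) ^ 2) := by
  have h := Finset.card_eq_sum_card_fiberwise
    (s := univ.filter fun s : Fin kk → BVec n => glQuery kk s T i ∈ G ∧ glQuery kk s T' i ∈ G)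
    (t := G ×ˢ G) (f := fun s => (glQuery kk s T i, glQuery kk s T' i))
    fun s hs => mem_product.2 (mem_filter.1 hs).2
  rw [h, Nat.cast_sum]
  have : ∀ p ∈ G ×ˢ G, (((univ.filter fun s : Fin kk → BVec n =>
      glQuery kk s T i ∈ G ∧ glQuery kk s T' i ∈ G).filter
        fun s => (glQuery kk s T i, glQuery kk s T' i) = p).card : ℝ) =
        Fintype.card (Fin kk → BVec n) / Fintype.card (BVec n) ^ 2 := by
    rintro ⟨v, v'⟩ hp
    obtain ⟨hv, hv'⟩ := mem_product.1 hp
    rw [Finset.filter_filter,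
      ← card_fibre_seedSum_pair kk hT hT' hne (v - Pi.single i 1) (v' - Pi.single i 1)]
    congr 2; ext s'
    simp only [mem_filter, mem_univ, true_and, glQuery, Prod.mk.injEq]
    constructor
    · rintro ⟨-, h, h'⟩
      rw [← h, ← h', add_sub_cancel_right, add_sub_cancel_right]; exact ⟨rfl, rfl⟩
    · rintro ⟨h, h'⟩; rw [h, h', sub_add_cancel, sub_add_cancel]; exact ⟨⟨hv, hv'⟩, rfl, rfl⟩
  rw [Finset.sum_congr rfl this, Finset.sum_const, nsmul_eq_mul, card_product, Nat.cast_mul]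
  ring

variable (B : BVec n → ZMod 2) (x : BVec n)

/-- The agreement set of the predictor `B` with the linear function `⟨x, ·⟩`. [folklore] -/
def glGood : Finset (BVec n) := univ.filter fun r => B r = x ⬝ᵥ r

/-- The number of nonempty subsets `T` whose vote for coordinate `i` is right under the
correct guess, i.e. whose query point is in the agreement set (AB's `Z = Σ_j Z_j`).
[cite: AroraBarak2009, Thm. 9.12 (proof)] -/
def correctVotes (s : Fin kk → BVec n) (i : Fin n) : ℕ :=
  ((nonemptySubsets kk).filter fun T => glQuery kk s T i ∈ glGood B x).card

/-- `E[Z]`: `Σ_s Z(s) = m · |G| · |Ω| / |V|`. [cite: AroraBarak2009, Thm. 9.12 (proof)] -/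
theorem sum_correctVotes (i : Fin n) :
    (∑ s : Fin kk → BVec n, (correctVotes kk B x s i : ℝ)) =
      (2 ^ kk - 1 : ℕ) * ((glGood B x).card *
        (Fintype.card (Fin kk → BVec n) / Fintype.card (BVec n))) := by
  unfold correctVotes
  simp_rw [natCast_card_filter]
  rw [Finset.sum_comm]
  have h1 : ∀ T ∈ nonemptySubsets kk,
      (∑ s : Fin kk → BVec n, (if glQuery kk s T i ∈ glGood B x then (1 : ℝ) else 0)) =
        (glGood B x).card * (Fintype.card (Fin kk → BVec n) / Fintype.card (BVec n)) :=
    fun T hT => by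
      rw [← natCast_card_filter]
      exact card_filter_glQuery_mem kk T (mem_filter.1 hT).2 i (glGood B x)
  rw [Finset.sum_congr rfl h1, Finset.sum_const, nsmul_eq_mul, card_nonemptySubsets]

/-- `E[Z²]`: `Σ_s Z(s)² = m·a + m(m-1)·b` with `a = |G||Ω|/|V|`, `b = |G|²|Ω|/|V|²`.
[cite: AroraBarak2009, Thm. 9.12 (proof, "`Var(Σ Zⱼ) = Σ Var(Zⱼ)` for pairwise independent")] -/
theorem sum_correctVotes_sq (i : Fin n) :
    (∑ s : Fin kk → BVec n, (correctVotes kk B x s i : ℝ) ^ 2) =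
      (2 ^ kk - 1 : ℕ) * ((glGood B x).card *
        (Fintype.card (Fin kk → BVec n) / Fintype.card (BVec n)) +
        ((2 ^ kk - 1 : ℕ) - 1) * ((glGood B x).card ^ 2 *
          (Fintype.card (Fin kk → BVec n) / Fintype.card (BVec n) ^ 2))) := by
  unfold correctVotes
  simp_rw [natCast_card_filter]
  rw [Finset.sum_congr rfl fun s _ => by rw [sq, Finset.sum_mul_sum]]
  rw [Finset.sum_comm]
  rw [← card_nonemptySubsets kk, ← nsmul_eq_mul, ← Finset.sum_const]
  refine Finset.sum_congr rfl fun T hT => ?_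
  have hTne : T.Nonempty := (mem_filter.1 hT).2
  rw [Finset.sum_comm, ← Finset.add_sum_erase _ _ hT]
  congr 1
  · -- the diagonal term `T' = T`
    rw [← card_filter_glQuery_mem kk T hTne i (glGood B x), natCast_card_filter]
    refine Finset.sum_congr rfl fun s _ => ?_
    split_ifs <;> simp
  · -- the off-diagonal terms
    rw [Finset.sum_congr rfl fun T' hT' => by
      have hT'ne : T'.Nonempty := (mem_filter.1 (mem_of_mem_erase hT')).2
      have hne : T ≠ T' := fun h => (Finset.mem_erase.1 hT').1 h.symm
      rw [show (∑ s : Fin kk → BVec n, (if glQuery kk s T i ∈ glGood B x then (1 : ℝ) else 0) *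
          (if glQuery kk s T' i ∈ glGood B x then (1 : ℝ) else 0)) =
          ∑ s : Fin kk → BVec n, (if glQuery kk s T i ∈ glGood B x ∧ glQuery kk s T' i ∈ glGood B x
            then (1 : ℝ) else 0) from Finset.sum_congr rfl fun s _ => by
              rw [ite_zero_mul_ite_zero, one_mul],
        ← natCast_card_filter, card_filter_glQuery_mem_pair kk hTne hT'ne hne i (glGood B x)]]
    have h1 : 1 ≤ 2 ^ kk - 1 := by
      have : 0 < (nonemptySubsets kk).card := card_pos.2 ⟨T, hT⟩
      rwa [card_nonemptySubsets] at this
    rw [Finset.sum_const, nsmul_eq_mul, card_erase_of_mem hT, card_nonemptySubsets,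
      Nat.cast_sub h1, Nat.cast_one]

end Analysis

/-! ### Chebyshev, correctness of the majority vote, and the union bound -/

section Main

variable (kk) (B : BVec n → ZMod 2) (x : BVec n)

/-- The sum of squared deviations of `Z` from `m·p`, `p = |G|/|V|`: exactly `|Ω| m p (1 - p)`
(variance of a sum of `m` pairwise independent indicators).
[cite: AroraBarak2009, Thm. 9.12 (proof) with Claim A.13] -/
theorem sum_sq_deviation (i : Fin n) :
    (∑ s : Fin kk → BVec n,
      ((correctVotes kk B x s i : ℝ) -
        (2 ^ kk - 1 : ℕ) * ((glGood B x).card / Fintype.card (BVec n))) ^ 2) =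
      Fintype.card (Fin kk → BVec n) * (2 ^ kk - 1 : ℕ) *
        ((glGood B x).card / Fintype.card (BVec n)) *
          (1 - (glGood B x).card / Fintype.card (BVec n)) := by
  have hV : (0 : ℝ) < Fintype.card (BVec n) := Nat.cast_pos.2 Fintype.card_pos
  have h1 := sum_correctVotes kk B x i
  have h2 := sum_correctVotes_sq kk B x i
  simp_rw [sub_sq]
  rw [Finset.sum_add_distrib, Finset.sum_sub_distrib, h2, Finset.sum_const, card_univ,
    nsmul_eq_mul]
  have h3 : (∑ s : Fin kk → BVec n, 2 * (correctVotes kk B x s i : ℝ) *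
      ((2 ^ kk - 1 : ℕ) * ((glGood B x).card / Fintype.card (BVec n)))) =
      2 * ((2 ^ kk - 1 : ℕ) * ((glGood B x).card / Fintype.card (BVec n))) *
        ∑ s : Fin kk → BVec n, (correctVotes kk B x s i : ℝ) := by
    rw [Finset.mul_sum]
    exact Finset.sum_congr rfl fun s _ => by ring
  rw [h3, h1]
  field_simp
  ring

variable {γ : ℝ}

/-- **Chebyshev step**: if `B` agrees with `⟨x, ·⟩` on a `≥ 1/2 + γ` fraction of points, then
for each coordinate `i` the seeds for which at most half of the nonempty subsets vote
correctly are few: `#bad_i ≤ |Ω| / (4 γ² m)`.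
[cite: AroraBarak2009, Thm. 9.12 (proof, "By Chebychev's Inequality … `Pr[|Z - E[Z]| ≥ …]`")] -/
theorem card_badSeeds_le (hγ : 0 < γ)
    (hB : (1 / 2 + γ) * Fintype.card (BVec n) ≤ ((glGood B x).card : ℝ)) (hk : 0 < kk)
    (i : Fin n) :
    ((univ.filter fun s : Fin kk → BVec n =>
        2 * correctVotes kk B x s i ≤ 2 ^ kk - 1).card : ℝ) ≤
      Fintype.card (Fin kk → BVec n) / (4 * γ ^ 2 * (2 ^ kk - 1 : ℕ)) := by
  have hV : (0 : ℝ) < Fintype.card (BVec n) := Nat.cast_pos.2 Fintype.card_pos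
  set m : ℕ := 2 ^ kk - 1 with hm
  have hm1 : 1 ≤ m := by
    have : 2 ≤ 2 ^ kk := by
      calc 2 = 2 ^ 1 := by norm_num
        _ ≤ 2 ^ kk := Nat.pow_le_pow_right (by norm_num) hk
    omega
  have hmpos : (0 : ℝ) < m := by exact_mod_cast hm1
  set p : ℝ := (glGood B x).card / Fintype.card (BVec n) with hp
  have hp1 : 1 / 2 + γ ≤ p := by rw [hp, le_div_iff₀ hV]; exact hB
  have hple : p ≤ 1 := by
    rw [hp, div_le_one hV]
    exact_mod_cast (card_filter_le _ _).trans_eq (card_univ)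
  set bad := univ.filter fun s : Fin kk → BVec n => 2 * correctVotes kk B x s i ≤ m
  -- each bad seed deviates by at least `m γ`
  have hdev : ∀ s ∈ bad, ((m : ℝ) * γ) ^ 2 ≤ ((correctVotes kk B x s i : ℝ) - m * p) ^ 2 := by
    intro s hs
    have hs' : 2 * (correctVotes kk B x s i : ℝ) ≤ m := by
      exact_mod_cast (mem_filter.1 hs).2
    have hle : (m : ℝ) * γ ≤ m * p - correctVotes kk B x s i := by nlinarith
    calc ((m : ℝ) * γ) ^ 2 ≤ (m * p - correctVotes kk B x s i) ^ 2 := by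
          have h0 : (0 : ℝ) ≤ m * γ := by positivity
          nlinarith
      _ = ((correctVotes kk B x s i : ℝ) - m * p) ^ 2 := by ring
  have hsum : (bad.card : ℝ) * ((m : ℝ) * γ) ^ 2 ≤
      Fintype.card (Fin kk → BVec n) * m * p * (1 - p) := by
    rw [← sum_sq_deviation kk B x i, ← nsmul_eq_mul, ← Finset.sum_const]
    exact (Finset.sum_le_sum hdev).trans
      (Finset.sum_le_sum_of_subset_of_nonneg (subset_univ _) fun s _ _ => sq_nonneg _)
  have hp4 : p * (1 - p) ≤ 1 / 4 := by nlinarith [sq_nonneg (p - 1 / 2)]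
  have hΩ : (0 : ℝ) ≤ Fintype.card (Fin kk → BVec n) := Nat.cast_nonneg _
  rw [le_div_iff₀ (by positivity)]
  calc (bad.card : ℝ) * (4 * γ ^ 2 * m) = (bad.card * (m * γ) ^ 2) * (4 / m) := by
        field_simp
    _ ≤ (Fintype.card (Fin kk → BVec n) * m * p * (1 - p)) * (4 / m) := by
        gcongr
    _ = Fintype.card (Fin kk → BVec n) * (4 * (p * (1 - p))) := by field_simp
    _ ≤ Fintype.card (Fin kk → BVec n) * 1 := by gcongr; linarith
    _ = Fintype.card (Fin kk → BVec n) := mul_one _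

/-- **The majority vote is right when most subsets vote correctly**: if more than half of the
nonempty subsets have their query point in the agreement set, coordinate `i` of Rackoff's
candidate (for the correct guess) equals `xᵢ`. [cite: AroraBarak2009, Thm. 9.12 (proof)] -/
theorem glCandidate_trueGuess_apply (s : Fin kk → BVec n) (i : Fin n)
    (h : 2 ^ kk - 1 < 2 * correctVotes kk B x s i) :
    glCandidate B kk s (trueGuess x s) i = x i := by
  have hiff : ∀ T, glVote B s (trueGuess x s) T i = x i ↔ glQuery kk s T i ∈ glGood B x := by
    intro T
    rw [glVote_trueGuess_eq_iff]
    simp [glGood, glQuery]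
  unfold glCandidate
  rw [card_nonemptySubsets]
  unfold correctVotes at h
  rcases (by decide : ∀ c : ZMod 2, c = 0 ∨ c = 1) (x i) with hx | hx
  · -- `xᵢ = 0`: the subsets voting `1` are exactly the wrong ones
    rw [hx, if_neg]
    have hset : ((nonemptySubsets kk).filter fun T => glVote B s (trueGuess x s) T i = 1) =
        (nonemptySubsets kk).filter fun T => ¬ glQuery kk s T i ∈ glGood B x := by
      refine Finset.filter_congr fun T _ => ?_
      rw [← hiff T, hx]
      generalize glVote B s (trueGuess x s) T i = c
      revert c; decide
    rw [hset]
    have := Finset.card_filter_add_card_filter_not (s := nonemptySubsets kk)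
      (fun T => glQuery kk s T i ∈ glGood B x)
    rw [card_nonemptySubsets] at this
    omega
  · -- `xᵢ = 1`: the subsets voting `1` are exactly the right ones
    rw [hx, if_pos]
    have hset : ((nonemptySubsets kk).filter fun T => glVote B s (trueGuess x s) T i = 1) =
        (nonemptySubsets kk).filter fun T => glQuery kk s T i ∈ glGood B x :=
      Finset.filter_congr fun T _ => by rw [← hiff T, hx]
    rwa [hset]

/-- **Goldreich–Levin, combinatorial core** (Rackoff's proof, Arora–Barak Thm. 9.12; the list
form is CIKK Thm. 4.2 with `p = 2`): if `B : 𝔽₂ⁿ → 𝔽₂` agrees with the linear function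
`r ↦ ⟨x, r⟩` on at least a `1/2 + γ` fraction of `𝔽₂ⁿ`, then for all but a
`n / (4 γ² (2^k - 1))` fraction of the seed tuples `s ∈ (𝔽₂ⁿ)^k` the secret `x` is on the
Goldreich–Levin list `glList B k s` (which has `≤ 2^k` elements and is computed from `n(2^k-1)`
queries to `B`). [cite: AroraBarak2009, Thm. 9.12] -/
theorem goldreich_levin_core (hγ : 0 < γ)
    (hB : (1 / 2 + γ) * Fintype.card (BVec n) ≤
      ((univ.filter fun r : BVec n => B r = x ⬝ᵥ r).card : ℝ)) (hk : 0 < kk) :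
    ((univ.filter fun s : Fin kk → BVec n => x ∉ glList B kk s).card : ℝ) ≤
      n / (4 * γ ^ 2 * (2 ^ kk - 1 : ℕ)) * Fintype.card (Fin kk → BVec n) := by
  -- a seed is bad for the list only if some coordinate's majority vote fails
  have hsub : (univ.filter fun s : Fin kk → BVec n => x ∉ glList B kk s) ⊆
      (univ : Finset (Fin n)).biUnion fun i =>
        univ.filter fun s : Fin kk → BVec n => 2 * correctVotes kk B x s i ≤ 2 ^ kk - 1 := by
    intro s hs
    rw [mem_filter] at hs
    rw [mem_biUnion]
    by_contra hall
    apply hs.2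
    have : glCandidate B kk s (trueGuess x s) = x := by
      funext i
      apply glCandidate_trueGuess_apply
      by_contra hi
      exact hall ⟨i, mem_univ i, mem_filter.2 ⟨mem_univ s, not_lt.1 hi⟩⟩
    rw [← this]
    exact glCandidate_trueGuess_mem B x s
  calc ((univ.filter fun s : Fin kk → BVec n => x ∉ glList B kk s).card : ℝ)
      ≤ ((univ : Finset (Fin n)).biUnion fun i => univ.filter fun s : Fin kk → BVec n =>
          2 * correctVotes kk B x s i ≤ 2 ^ kk - 1).card := by exact_mod_cast card_le_card hsub
    _ ≤ ∑ i : Fin n, ((univ.filter fun s : Fin kk → BVec n =>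
          2 * correctVotes kk B x s i ≤ 2 ^ kk - 1).card : ℝ) := by
        exact_mod_cast card_biUnion_le
    _ ≤ ∑ _i : Fin n, Fintype.card (Fin kk → BVec n) / (4 * γ ^ 2 * (2 ^ kk - 1 : ℕ)) :=
        Finset.sum_le_sum fun i _ => card_badSeeds_le kk B x hγ hB hk i
    _ = n / (4 * γ ^ 2 * (2 ^ kk - 1 : ℕ)) * Fintype.card (Fin kk → BVec n) := by
        rw [Finset.sum_const, card_univ, Fintype.card_fin, nsmul_eq_mul]; ring

/-- **Goldreich–Levin, probability-`1/2` form** (as used in CIKK Thm. 4.2): with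
`2^k - 1 ≥ n / (2γ²)` pairwise independent queries, for at least half of the seed tuples the
secret is on the list (the form quoted in CIKK Thm. 4.2).
[cite: AroraBarak2009, Thm. 9.12] -/
theorem goldreich_levin_half (hγ : 0 < γ)
    (hB : (1 / 2 + γ) * Fintype.card (BVec n) ≤
      ((univ.filter fun r : BVec n => B r = x ⬝ᵥ r).card : ℝ)) (hk : 0 < kk)
    (hm : (n : ℝ) ≤ 2 * γ ^ 2 * (2 ^ kk - 1 : ℕ)) :
    (Fintype.card (Fin kk → BVec n) : ℝ) / 2 ≤
      (univ.filter fun s : Fin kk → BVec n => x ∈ glList B kk s).card := by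
  have h := goldreich_levin_core kk B x hγ hB hk
  have hm1 : (0 : ℝ) < (2 ^ kk - 1 : ℕ) := by
    have : 2 ≤ 2 ^ kk := by
      calc 2 = 2 ^ 1 := by norm_num
        _ ≤ 2 ^ kk := Nat.pow_le_pow_right (by norm_num) hk
    have : 1 ≤ 2 ^ kk - 1 := by omega
    exact_mod_cast this
  have hcompl := Finset.card_filter_add_card_filter_not
    (s := (univ : Finset (Fin kk → BVec n))) (fun s => x ∈ glList B kk s)
  rw [card_univ] at hcompl
  have hc : ((univ.filter fun s : Fin kk → BVec n => x ∈ glList B kk s).card : ℝ) =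
      Fintype.card (Fin kk → BVec n) -
        (univ.filter fun s : Fin kk → BVec n => x ∉ glList B kk s).card := by
    rw [eq_sub_iff_add_eq]; exact_mod_cast hcompl
  rw [hc]
  have hfrac : (n : ℝ) / (4 * γ ^ 2 * (2 ^ kk - 1 : ℕ)) ≤ 1 / 2 := by
    rw [div_le_iff₀ (by positivity)]; linarith
  have hΩ : (0 : ℝ) ≤ Fintype.card (Fin kk → BVec n) := Nat.cast_nonneg _
  nlinarith [mul_le_mul_of_nonneg_right hfrac hΩ]

end Main

end Literature.Computability.Cryptography
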